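import Summits.NavierStokesRegularity.NavierStokesRegularity.Theses.OddMorawetz
import Literature.Analysis.FluidPDE.IsometryInvariance
import HarnessLib

/-!
# Route OddMorawetz — `MorawetzKillsTypeI`: isometry covariance of jets and of the Euler derivative

(crux item `stmt-NavierStokesRegularity-1377`, line `birth`; lands `--supports` the crux.)

For a linear isometry `R` of `ℝ³` write `R·v (x) := R (v (R⁻¹ x))` for the push-forward of a vector field
and `ρ_R` for the induced (linear) action on 3-jets,
`ρ_R (z₀, z₁, z₂, z₃) = (R z₀, R ∘ z₁ ∘ (R⁻¹)^{×1}, R ∘ z₂ ∘ (R⁻¹)^{×2}, R ∘ z₃ ∘ (R⁻¹)^{×3})`.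

* `rotate_isSchwartzField` — `R·v` is Schwartz when `v` is.
* `rotate_iteratedFDeriv` — `Dⁿ(R·v)(x) = R ∘ Dⁿv(R⁻¹x) ∘ (R⁻¹)^{×n}` (unconditional).
* `morawetzQ_rotate` — the COVARIANCE LAW of the Euler derivative of a smooth density `m` on 3-jets:
  `Q_m(R·v) = Q_{m ∘ ρ_R}(v)`, i.e.
  `−∫ Dm(J(R·v))[J B(R·v, R·v)] = −∫ D(m ∘ ρ_R)(Jv)[J B(v,v)]`, GIVEN the isometry covariance of the exact
  Euler bilinear operator `B(R·v, R·v) = R·B(v,v)` as a hypothesis (a registered stub of the line,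
  `stub_rotate_eulerBilinear`). Proof: the jets of `R·v` and of `R·B(v,v)` are `ρ_R` of the jets at `R⁻¹x`,
  the chain rule along the continuous linear map `ρ_R`, and the change of variables `x ↦ R⁻¹ x`
  (Lebesgue measure is isometry invariant).

These feed the hyperoctahedral-averaging argument that kills Morawetz certificates of derivative weight 1.
-/

noncomputable section

-- the route's Theorems namespace repeats the summit name by design (Summit.<S>.<P>.Theorems, S = P)
set_option linter.dupNamespace false

namespace Summit.NavierStokesRegularity.NavierStokesRegularity.Theorems

open MeasureTheory

/-- **Push-forward by a linear isometry preserves the Schwartz class**: if `v` is a Schwartz vector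
field on `ℝ³` and `R` a linear isometry, so is `x ↦ R (v (R⁻¹ x))` (post-compose Mathlib's Schwartz map
with the continuous linear map `R`, pre-compose with the continuous linear equivalence `R⁻¹`). -/
theorem rotate_isSchwartzField (R : EuclideanSpace ℝ (Fin 3) ≃ₗᵢ[ℝ] EuclideanSpace ℝ (Fin 3))
    {v : EuclideanSpace ℝ (Fin 3) → EuclideanSpace ℝ (Fin 3)}
    (hv : Literature.Analysis.FluidPDE.IsSchwartzField v) :
    Literature.Analysis.FluidPDE.IsSchwartzField (fun x => R (v (R.symm x))) := by
  obtain ⟨f, rfl⟩ := hv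
  refine ⟨SchwartzMap.postcompCLM (𝕜 := ℝ) (R.toContinuousLinearEquiv : EuclideanSpace ℝ (Fin 3) →L[ℝ] EuclideanSpace ℝ (Fin 3))
    (SchwartzMap.compCLMOfContinuousLinearEquiv ℝ R.symm.toContinuousLinearEquiv f), ?_⟩
  funext x
  rfl

/-- **Jets of a pushed-forward field**: for a linear isometry `R` of `ℝ³`, every `n`, every field `v` and
every point `x`, `Dⁿ(R·v)(x) = R ∘ Dⁿv(R⁻¹ x) ∘ (R⁻¹, …, R⁻¹)` as continuous multilinear maps
(`ContinuousLinearEquiv.iteratedFDeriv_comp_left`, `ContinuousLinearEquiv.iteratedFDerivWithin_comp_right`;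
unconditional, both sides being the junk `0` off the differentiability locus). -/
theorem rotate_iteratedFDeriv (R : EuclideanSpace ℝ (Fin 3) ≃ₗᵢ[ℝ] EuclideanSpace ℝ (Fin 3)) (n : ℕ)
    (v : EuclideanSpace ℝ (Fin 3) → EuclideanSpace ℝ (Fin 3)) (x : EuclideanSpace ℝ (Fin 3)) :
    iteratedFDeriv ℝ n (fun x => R (v (R.symm x))) x =
      (R.toContinuousLinearEquiv : EuclideanSpace ℝ (Fin 3) →L[ℝ] EuclideanSpace ℝ (Fin 3)).compContinuousMultilinearMap
        ((iteratedFDeriv ℝ n v (R.symm x)).compContinuousLinearMap fun _ =>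
          (R.symm.toContinuousLinearEquiv : EuclideanSpace ℝ (Fin 3) →L[ℝ] EuclideanSpace ℝ (Fin 3))) := by
  have e1 : (fun x => R (v (R.symm x))) = R.toContinuousLinearEquiv ∘ (v ∘ R.symm.toContinuousLinearEquiv) := rfl
  rw [e1, ContinuousLinearEquiv.iteratedFDeriv_comp_left]
  congr 1
  have h := R.symm.toContinuousLinearEquiv.iteratedFDerivWithin_comp_right v uniqueDiffOn_univ
    (Set.mem_univ _) n (x := x)
  simp only [Set.preimage_univ, iteratedFDerivWithin_univ] at h
  exact h

/-- **Isometry covariance of the Euler derivative of a smooth density** (given the covariance of the Euler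
bilinear operator as the hypothesis `hB`, = the line's `stub_rotate_eulerBilinear`). For a linear isometry
`R` of `ℝ³`, a smooth density `m` on 3-jets and every field `v`:
`−∫ Dm(J(R·v))[J B(R·v,R·v)] = −∫ D(m ∘ ρ_R)(Jv)[J B(v,v)]`, where `R·v (x) = R (v (R⁻¹x))`,
`Jv(x) = (v x, Dv x, D²v x, D³v x)` and `ρ_R` is the linear jet action (written out in the statement). -/
theorem morawetzQ_rotate :
    ∀ (hB : ∀ (R : EuclideanSpace ℝ (Fin 3) ≃ₗᵢ[ℝ] EuclideanSpace ℝ (Fin 3))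
      (v : EuclideanSpace ℝ (Fin 3) → EuclideanSpace ℝ (Fin 3)),
      Literature.Analysis.FluidPDE.eulerBilinear (fun x => R (v (R.symm x))) (fun x => R (v (R.symm x))) =
        fun x => R (Literature.Analysis.FluidPDE.eulerBilinear v v (R.symm x)))
    {m : EuclideanSpace ℝ (Fin 3) × (EuclideanSpace ℝ (Fin 3) [×1]→L[ℝ] EuclideanSpace ℝ (Fin 3)) × (EuclideanSpace ℝ (Fin 3) [×2]→L[ℝ] EuclideanSpace ℝ (Fin 3)) × (EuclideanSpace ℝ (Fin 3) [×3]→L[ℝ] EuclideanSpace ℝ (Fin 3)) → ℝ}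
    (hsm : ContDiff ℝ (⊤ : ℕ∞) m)
    (R : EuclideanSpace ℝ (Fin 3) ≃ₗᵢ[ℝ] EuclideanSpace ℝ (Fin 3))
    (v : EuclideanSpace ℝ (Fin 3) → EuclideanSpace ℝ (Fin 3)),
    (-∫ x, fderiv ℝ m
        ((fun x => R (v (R.symm x))) x, iteratedFDeriv ℝ 1 (fun x => R (v (R.symm x))) x,
          iteratedFDeriv ℝ 2 (fun x => R (v (R.symm x))) x, iteratedFDeriv ℝ 3 (fun x => R (v (R.symm x))) x)
        (Literature.Analysis.FluidPDE.eulerBilinear (fun x => R (v (R.symm x))) (fun x => R (v (R.symm x))) x,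
          iteratedFDeriv ℝ 1 (Literature.Analysis.FluidPDE.eulerBilinear (fun x => R (v (R.symm x))) (fun x => R (v (R.symm x)))) x,
          iteratedFDeriv ℝ 2 (Literature.Analysis.FluidPDE.eulerBilinear (fun x => R (v (R.symm x))) (fun x => R (v (R.symm x)))) x,
          iteratedFDeriv ℝ 3 (Literature.Analysis.FluidPDE.eulerBilinear (fun x => R (v (R.symm x))) (fun x => R (v (R.symm x)))) x)) =
      -∫ x, fderiv ℝ (fun z : EuclideanSpace ℝ (Fin 3) × (EuclideanSpace ℝ (Fin 3) [×1]→L[ℝ] EuclideanSpace ℝ (Fin 3)) × (EuclideanSpace ℝ (Fin 3) [×2]→L[ℝ] EuclideanSpace ℝ (Fin 3)) × (EuclideanSpace ℝ (Fin 3) [×3]→L[ℝ] EuclideanSpace ℝ (Fin 3)) =>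
          m (R z.1,
            (R.toContinuousLinearEquiv : EuclideanSpace ℝ (Fin 3) →L[ℝ] EuclideanSpace ℝ (Fin 3)).compContinuousMultilinearMap
              (z.2.1.compContinuousLinearMap fun _ =>
                (R.symm.toContinuousLinearEquiv : EuclideanSpace ℝ (Fin 3) →L[ℝ] EuclideanSpace ℝ (Fin 3))),
            (R.toContinuousLinearEquiv : EuclideanSpace ℝ (Fin 3) →L[ℝ] EuclideanSpace ℝ (Fin 3)).compContinuousMultilinearMap
              (z.2.2.1.compContinuousLinearMap fun _ =>
                (R.symm.toContinuousLinearEquiv : EuclideanSpace ℝ (Fin 3) →L[ℝ] EuclideanSpace ℝ (Fin 3))),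
            (R.toContinuousLinearEquiv : EuclideanSpace ℝ (Fin 3) →L[ℝ] EuclideanSpace ℝ (Fin 3)).compContinuousMultilinearMap
              (z.2.2.2.compContinuousLinearMap fun _ =>
                (R.symm.toContinuousLinearEquiv : EuclideanSpace ℝ (Fin 3) →L[ℝ] EuclideanSpace ℝ (Fin 3)))))
        (v x, iteratedFDeriv ℝ 1 v x, iteratedFDeriv ℝ 2 v x, iteratedFDeriv ℝ 3 v x)
        (Literature.Analysis.FluidPDE.eulerBilinear v v x,
          iteratedFDeriv ℝ 1 (Literature.Analysis.FluidPDE.eulerBilinear v v) x,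
          iteratedFDeriv ℝ 2 (Literature.Analysis.FluidPDE.eulerBilinear v v) x,
          iteratedFDeriv ℝ 3 (Literature.Analysis.FluidPDE.eulerBilinear v v) x) := by
  intro hB m hsm R v
  -- abbreviations
  set Rc : EuclideanSpace ℝ (Fin 3) →L[ℝ] EuclideanSpace ℝ (Fin 3) :=
    (R.toContinuousLinearEquiv : EuclideanSpace ℝ (Fin 3) →L[ℝ] EuclideanSpace ℝ (Fin 3)) with hRc
  set Sc : EuclideanSpace ℝ (Fin 3) →L[ℝ] EuclideanSpace ℝ (Fin 3) :=
    (R.symm.toContinuousLinearEquiv : EuclideanSpace ℝ (Fin 3) →L[ℝ] EuclideanSpace ℝ (Fin 3)) with hSc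
  -- the jet action as a continuous linear map
  let ρ₁ : (EuclideanSpace ℝ (Fin 3) [×1]→L[ℝ] EuclideanSpace ℝ (Fin 3)) →L[ℝ]
      (EuclideanSpace ℝ (Fin 3) [×1]→L[ℝ] EuclideanSpace ℝ (Fin 3)) :=
    (ContinuousLinearMap.compContinuousMultilinearMapL ℝ (fun _ : Fin 1 => EuclideanSpace ℝ (Fin 3))
        (EuclideanSpace ℝ (Fin 3)) (EuclideanSpace ℝ (Fin 3)) Rc).comp
      (ContinuousMultilinearMap.compContinuousLinearMapL fun _ : Fin 1 => Sc)
  let ρ₂ : (EuclideanSpace ℝ (Fin 3) [×2]→L[ℝ] EuclideanSpace ℝ (Fin 3)) →L[ℝ]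
      (EuclideanSpace ℝ (Fin 3) [×2]→L[ℝ] EuclideanSpace ℝ (Fin 3)) :=
    (ContinuousLinearMap.compContinuousMultilinearMapL ℝ (fun _ : Fin 2 => EuclideanSpace ℝ (Fin 3))
        (EuclideanSpace ℝ (Fin 3)) (EuclideanSpace ℝ (Fin 3)) Rc).comp
      (ContinuousMultilinearMap.compContinuousLinearMapL fun _ : Fin 2 => Sc)
  let ρ₃ : (EuclideanSpace ℝ (Fin 3) [×3]→L[ℝ] EuclideanSpace ℝ (Fin 3)) →L[ℝ]
      (EuclideanSpace ℝ (Fin 3) [×3]→L[ℝ] EuclideanSpace ℝ (Fin 3)) :=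
    (ContinuousLinearMap.compContinuousMultilinearMapL ℝ (fun _ : Fin 3 => EuclideanSpace ℝ (Fin 3))
        (EuclideanSpace ℝ (Fin 3)) (EuclideanSpace ℝ (Fin 3)) Rc).comp
      (ContinuousMultilinearMap.compContinuousLinearMapL fun _ : Fin 3 => Sc)
  let ρ : (EuclideanSpace ℝ (Fin 3) × (EuclideanSpace ℝ (Fin 3) [×1]→L[ℝ] EuclideanSpace ℝ (Fin 3)) ×
      (EuclideanSpace ℝ (Fin 3) [×2]→L[ℝ] EuclideanSpace ℝ (Fin 3)) ×
      (EuclideanSpace ℝ (Fin 3) [×3]→L[ℝ] EuclideanSpace ℝ (Fin 3))) →L[ℝ]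
      (EuclideanSpace ℝ (Fin 3) × (EuclideanSpace ℝ (Fin 3) [×1]→L[ℝ] EuclideanSpace ℝ (Fin 3)) ×
      (EuclideanSpace ℝ (Fin 3) [×2]→L[ℝ] EuclideanSpace ℝ (Fin 3)) ×
      (EuclideanSpace ℝ (Fin 3) [×3]→L[ℝ] EuclideanSpace ℝ (Fin 3))) :=
    Rc.prodMap (ρ₁.prodMap (ρ₂.prodMap ρ₃))
  have hρ : ∀ (a₀ : EuclideanSpace ℝ (Fin 3))
      (a₁ : EuclideanSpace ℝ (Fin 3) [×1]→L[ℝ] EuclideanSpace ℝ (Fin 3))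
      (a₂ : EuclideanSpace ℝ (Fin 3) [×2]→L[ℝ] EuclideanSpace ℝ (Fin 3))
      (a₃ : EuclideanSpace ℝ (Fin 3) [×3]→L[ℝ] EuclideanSpace ℝ (Fin 3)),
      ρ (a₀, a₁, a₂, a₃) = (R a₀, Rc.compContinuousMultilinearMap (a₁.compContinuousLinearMap fun _ => Sc),
        Rc.compContinuousMultilinearMap (a₂.compContinuousLinearMap fun _ => Sc),
        Rc.compContinuousMultilinearMap (a₃.compContinuousLinearMap fun _ => Sc)) := by
    intro a₀ a₁ a₂ a₃
    rfl
  -- the density composed with the jet action, as in the statement, is `m ∘ ρ`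
  set mρ : EuclideanSpace ℝ (Fin 3) × (EuclideanSpace ℝ (Fin 3) [×1]→L[ℝ] EuclideanSpace ℝ (Fin 3)) ×
      (EuclideanSpace ℝ (Fin 3) [×2]→L[ℝ] EuclideanSpace ℝ (Fin 3)) ×
      (EuclideanSpace ℝ (Fin 3) [×3]→L[ℝ] EuclideanSpace ℝ (Fin 3)) → ℝ := fun z =>
    m (R z.1, Rc.compContinuousMultilinearMap (z.2.1.compContinuousLinearMap fun _ => Sc),
      Rc.compContinuousMultilinearMap (z.2.2.1.compContinuousLinearMap fun _ => Sc),
      Rc.compContinuousMultilinearMap (z.2.2.2.compContinuousLinearMap fun _ => Sc)) with hmρ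
  have hmρ' : mρ = m ∘ ρ := by
    funext z
    obtain ⟨a₀, a₁, a₂, a₃⟩ := z
    simp only [hmρ, Function.comp_apply, hρ]
  -- chain rule along `ρ`
  have hchain : ∀ (z w : EuclideanSpace ℝ (Fin 3) × (EuclideanSpace ℝ (Fin 3) [×1]→L[ℝ] EuclideanSpace ℝ (Fin 3)) ×
      (EuclideanSpace ℝ (Fin 3) [×2]→L[ℝ] EuclideanSpace ℝ (Fin 3)) ×
      (EuclideanSpace ℝ (Fin 3) [×3]→L[ℝ] EuclideanSpace ℝ (Fin 3))),
      fderiv ℝ mρ z w = fderiv ℝ m (ρ z) (ρ w) := by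
    intro z w
    have hdm : DifferentiableAt ℝ m (ρ z) := (hsm.differentiable (by simp)).differentiableAt
    rw [hmρ', fderiv_comp _ hdm ρ.differentiableAt, ContinuousLinearMap.fderiv, ContinuousLinearMap.comp_apply]
  -- the pushed-forward field and its Euler term
  set b := Literature.Analysis.FluidPDE.eulerBilinear v v with hb
  have hBv : Literature.Analysis.FluidPDE.eulerBilinear (fun x => R (v (R.symm x))) (fun x => R (v (R.symm x))) =
      fun x => R (b (R.symm x)) := hB R v
  -- the integrand of the pushed-forward field is the `m ∘ ρ` integrand at `R⁻¹ x`
  set F : EuclideanSpace ℝ (Fin 3) → ℝ := fun y =>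
    fderiv ℝ mρ (v y, iteratedFDeriv ℝ 1 v y, iteratedFDeriv ℝ 2 v y, iteratedFDeriv ℝ 3 v y)
      (b y, iteratedFDeriv ℝ 1 b y, iteratedFDeriv ℝ 2 b y, iteratedFDeriv ℝ 3 b y) with hF
  have hpt : (fun x => fderiv ℝ m
        ((fun x => R (v (R.symm x))) x, iteratedFDeriv ℝ 1 (fun x => R (v (R.symm x))) x,
          iteratedFDeriv ℝ 2 (fun x => R (v (R.symm x))) x, iteratedFDeriv ℝ 3 (fun x => R (v (R.symm x))) x)
        (Literature.Analysis.FluidPDE.eulerBilinear (fun x => R (v (R.symm x))) (fun x => R (v (R.symm x))) x,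
          iteratedFDeriv ℝ 1 (Literature.Analysis.FluidPDE.eulerBilinear (fun x => R (v (R.symm x))) (fun x => R (v (R.symm x)))) x,
          iteratedFDeriv ℝ 2 (Literature.Analysis.FluidPDE.eulerBilinear (fun x => R (v (R.symm x))) (fun x => R (v (R.symm x)))) x,
          iteratedFDeriv ℝ 3 (Literature.Analysis.FluidPDE.eulerBilinear (fun x => R (v (R.symm x))) (fun x => R (v (R.symm x)))) x)) =
      fun x => F (R.symm x) := by
    funext x
    rw [hBv]
    simp only [rotate_iteratedFDeriv, hF, hchain, hρ]
    rfl
  -- change of variables `x ↦ R⁻¹ x`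
  have hcv : ∫ x, F (R.symm x) = ∫ y, F y :=
    (R.symm.measurePreserving).integral_comp R.symm.toHomeomorph.measurableEmbedding F
  rw [hpt, hcv]

end Summit.NavierStokesRegularity.NavierStokesRegularity.Theorems

end
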